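import Mathlib
import Literature.Analysis.FluidPDE.JiaSverak2015.Statements

/-!
# Runbook sanity module — the typed Jia–Šverák (2015) programme statements are consistent, non-trivial, and carry exactly the content of the cited leaves

`Literature.Analysis.FluidPDE.JiaSverak2015.Setting.assembly_A` / `assembly_B` (bundle
`papers/NavierStokesRegularity/ns-jia-sverak`, REVIEW-RUNBOOK.md cards S1–S2, D1–D7, C1) are the modus
ponens "published leaf (JS15 Thm. 5.1 / 5.2, the hypothesis STRUCTURE `JS15Leaves`) + spectral scenario
(A) / (B)+ND1+ND2 ⇒ two distinct Leray–Hopf solutions with a common compactly supported datum".  The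
objects are carried by an ABSTRACT `Setting` (no spectral theory of the linearised operator `𝓛_U` on
`X = L² ∩ L⁴` exists in Mathlib).  This module records, kernel-checked, what the review cards ask about
such a statement ((b)-type sanity witnesses; nothing here is a claim about Navier–Stokes):

* `spectralA_toyHopf`, `spectralB_nd_toyReal` — the spectral scenarios (A) and (B) ∧ (4.5) ∧ (4.6), AS
  TYPED, are each satisfiable (on toy settings: carrier `Unit`, eigenvalue curve `σ ↦ σ ± i`, resp.
  `σ ↦ σ`), so neither hypothesis is contradictory and `assembly_A` / `assembly_B` are not `False → _`
  on the spectral side;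
* `not_spectralA_toyReal`, `not_spectralB_toyHopf`, `not_spectralA_toyEmpty` — the same predicates FAIL
  on other toy settings (a real crossing kills (A), a non-zero crossing kills (B), no spectrum kills
  both): the hypotheses are not trivially true either, and the tree's two kill criteria bite;
* `js15Leaves_toyEmpty` — the leaf structure `JS15Leaves` is inhabited OUTRIGHT (vacuously) on a
  setting where (A) and (B) never hold: a proof of `S.JS15Leaves` for SOME `S` is no evidence;
* `hypothesesA_satisfiable_iff`, `hypothesesB_satisfiable_iff` — the precise content statement: over
  the abstract `Setting`, the hypotheses of `assembly_A` (resp. `assembly_B`) are JOINTLY satisfiable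
  if and only if the local non-uniqueness CONCLUSION itself holds.  So the typed theorems transfer
  exactly the content of JS15 Thm. 5.1 / 5.2 and nothing more: no unconditional consequence can be
  extracted without instantiating `Setting` by the true operator (the future deliverable named in the
  `Setting` docstring) — the kernel form of the CAUTION in the `JS15Leaves` docstring and of the
  reviewer's advisory on p175635 ("`Setting` is junk-instantiable … `SpectralA 0 1` is provable").

The conclusion is written out at every use (it is deliberately not a named Prop in the tree).  The toy
settings are `def`s used by nothing else.
-/

namespace Summit.NavierStokesRegularity.NavierStokesRegularity.Theorems.RunbookJiaSverak

open Literature.Analysis.FluidPDE Literature.Analysis.FluidPDE.JiaSverak2015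

/-- Local notation for physical space `ℝ³ = EuclideanSpace ℝ (Fin 3)`. -/
local notation "ℝ³" => EuclideanSpace ℝ (Fin 3)

noncomputable section

/-- Toy setting realising scenario (A) at `σ₀ = 0`, `δ = 1`: carrier `Unit`; every profile "exists"; the
"eigenvalues of `𝓛_σ`" are the Hopf pair `σ ± i`; everything is "simple"; nothing is "in the range". -/
def toyHopf : Setting where
  X := Unit
  branchExists _ := True
  eig σ := {(σ : ℂ) + Complex.I, (σ : ℂ) - Complex.I}
  simple _ _ := True
  inRange _ _ := False
  nd1Vector _ := ()
  nd2Vector _ := ()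

/-- Toy setting realising scenario (B) with both non-degeneracy conditions at `σ₀ = 0`, `δ = 1`: the only
"eigenvalue of `𝓛_σ`" is the real number `σ`; nothing is "in the range" (so ND1, ND2 hold). -/
def toyReal : Setting where
  X := Unit
  branchExists _ := True
  eig σ := {(σ : ℂ)}
  simple _ _ := True
  inRange _ _ := False
  nd1Vector _ := ()
  nd2Vector _ := ()

/-- Toy setting with EMPTY spectrum: neither (A) nor (B) can hold at any `σ₀, δ`. -/
def toyEmpty : Setting where
  X := Unit
  branchExists _ := True
  eig _ := ∅
  simple _ _ := True
  inRange _ _ := False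
  nd1Vector _ := ()
  nd2Vector _ := ()

/-- Complex conjugate of `σ + i` is `σ − i` for real `σ`. -/
theorem conj_ofReal_add_I (σ : ℝ) :
    (starRingEnd ℂ) ((σ : ℂ) + Complex.I) = (σ : ℂ) - Complex.I := by
  rw [map_add, Complex.conj_ofReal, Complex.conj_I]; ring

/-- Scenario **(A)** is satisfiable as typed: it holds on `toyHopf` at `σ₀ = 0`, `δ = 1` with the
eigenvalue curve `lam₁ σ = σ + i` (`Re lam₁ σ = σ`, `Im lam₁ 0 = 1`, `(d/dσ) Re lam₁ = 1 > 0`). -/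
theorem spectralA_toyHopf : toyHopf.SpectralA 0 1 := by
  refine ⟨one_pos, fun _ _ => trivial, fun σ => (σ : ℂ) + Complex.I, ?_, ?_, ?_, ?_, ?_, ?_⟩
  · intro σ _ z hz
    rcases hz with rfl | rfl
    · exact Or.inr (Or.inl rfl)
    · exact Or.inr (Or.inr (by rw [Set.mem_singleton_iff, conj_ofReal_add_I]))
  · intro σ _
    exact ⟨Or.inl rfl, trivial, trivial⟩
  · intro σ hσ
    simpa using hσ
  · simp
  · simp
  · refine ⟨1, one_pos, ?_⟩
    have h : (fun σ : ℝ => (((σ : ℂ) + Complex.I).re)) = fun σ => σ := by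
      funext σ; simp
    rw [h]
    exact hasDerivAt_id 0

/-- Scenario **(B)** together with the non-degeneracy conditions **(4.5)**, **(4.6)** is satisfiable as
typed: all three hold on `toyReal` at `σ₀ = 0`, `δ = 1` with the real eigenvalue curve `lam₁ σ = σ`. -/
theorem spectralB_nd_toyReal : toyReal.SpectralB 0 1 ∧ toyReal.ND1 0 ∧ toyReal.ND2 0 := by
  refine ⟨⟨one_pos, fun _ _ => trivial, fun σ => σ, ?_, ?_, ?_, rfl⟩, not_false, not_false⟩
  · intro σ _ z hz
    exact Or.inr hz
  · intro σ _
    exact ⟨rfl, trivial⟩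
  · intro σ hσ
    exact hσ

/-- (A) is not trivially true: on `toyReal` the only eigenvalue on the imaginary axis at `σ₀ = 0` is `0`
(a REAL crossing), so (A) fails there for every gap `δ` — the tree's kill criterion
`not_spectralA_of_real_crossing` applied to a toy. -/
theorem not_spectralA_toyReal (δ : ℝ) : ¬ toyReal.SpectralA 0 δ :=
  toyReal.not_spectralA_of_real_crossing (σ₀ := 0) (fun z hz _ => by simpa [toyReal] using hz)

/-- (B) is not trivially true: on `toyHopf` the kernel of `𝓛_0` is empty (`0 ∉ {i, −i}`), so (B) fails
there for every `δ` — the tree's kill criterion `not_spectralB_of_no_kernel` applied to a toy. -/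
theorem not_spectralB_toyHopf (δ : ℝ) : ¬ toyHopf.SpectralB 0 δ := by
  refine toyHopf.not_spectralB_of_no_kernel (σ₀ := 0) ?_
  intro h
  simp only [toyHopf, Complex.ofReal_zero, zero_add, zero_sub, Set.mem_insert_iff,
    Set.mem_singleton_iff] at h
  rcases h with h | h
  · exact Complex.I_ne_zero h.symm
  · exact Complex.I_ne_zero (neg_eq_zero.mp h.symm)

/-- On the empty-spectrum toy, (A) fails at every `σ₀, δ` (it demands an eigenvalue `lam₁ σ₀`). -/
theorem not_spectralA_toyEmpty (σ₀ δ : ℝ) : ¬ toyEmpty.SpectralA σ₀ δ := by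
  rintro ⟨-, -, lam₁, -, hmem, -⟩
  exact (hmem σ₀ le_rfl).1

/-- On the empty-spectrum toy, (B) fails at every `σ₀, δ`. -/
theorem not_spectralB_toyEmpty (σ₀ δ : ℝ) : ¬ toyEmpty.SpectralB σ₀ δ := by
  rintro ⟨-, -, lam₁, -, hmem, -⟩
  exact (hmem σ₀ le_rfl).1

/-- The leaf structure `JS15Leaves` is inhabited OUTRIGHT on the empty-spectrum toy — vacuously, because
its two fields are implications from (A) resp. (B), which never hold there.  A proof of
`S.JS15Leaves` for SOME setting `S` is therefore no evidence of anything; only the `Setting` induced by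
the true operator `𝓛_U` makes it meaningful (as the `JS15Leaves` docstring says). -/
theorem js15Leaves_toyEmpty : toyEmpty.JS15Leaves where
  thm51 σ₀ δ hA := (not_spectralA_toyEmpty σ₀ δ hA).elim
  thm52 σ₀ δ hB _ _ := (not_spectralB_toyEmpty σ₀ δ hB).elim

/-- **Content statement for `assembly_A`.**  Over the abstract `Setting`, the hypotheses of `assembly_A`
— the leaf hypothesis `S.JS15Leaves` and scenario (A) at some `σ₀, δ` — are JOINTLY satisfiable if and
only if the local Leray–Hopf non-uniqueness conclusion itself holds.  (`→` is `assembly_A`; `←` takes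
`toyHopf`, where (A) holds, and fills both leaf fields with the assumed conclusion.)  So the typed
theorem carries exactly the content of JS15 Thm. 5.1 — no unconditional consequence is available
without instantiating `Setting` by the true linearised operator. -/
theorem hypothesesA_satisfiable_iff :
    (∃ (S : Setting) (σ₀ δ : ℝ), S.JS15Leaves ∧ S.SpectralA σ₀ δ) ↔
      (∃ (T : ℝ) (v₀ : ℝ³ → ℝ³) (u v : ℝ → ℝ³ → ℝ³), 0 < T ∧ JS15Datum v₀ ∧ IsNonUniqLHPair T v₀ u v) := by
  constructor
  · rintro ⟨S, σ₀, δ, L, hA⟩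
    exact S.assembly_A L hA
  · intro h
    exact ⟨toyHopf, 0, 1, ⟨fun _ _ _ => h, fun _ _ _ _ _ => h⟩, spectralA_toyHopf⟩

/-- **Content statement for `assembly_B`.**  The hypotheses of `assembly_B` — a leaf term, scenario (B)
and the non-degeneracy conditions ND1, ND2 at some `σ₀` — are jointly satisfiable over the abstract
`Setting` if and only if the conclusion holds (`→` is `assembly_B`; `←` uses `toyReal`). -/
theorem hypothesesB_satisfiable_iff :
    (∃ (S : Setting) (σ₀ δ : ℝ), S.JS15Leaves ∧ S.SpectralB σ₀ δ ∧ S.ND1 σ₀ ∧ S.ND2 σ₀) ↔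
      (∃ (T : ℝ) (v₀ : ℝ³ → ℝ³) (u v : ℝ → ℝ³ → ℝ³), 0 < T ∧ JS15Datum v₀ ∧ IsNonUniqLHPair T v₀ u v) := by
  constructor
  · rintro ⟨S, σ₀, δ, L, hB, h1, h2⟩
    exact S.assembly_B L hB h1 h2
  · intro h
    exact ⟨toyReal, 0, 1, ⟨fun _ _ _ => h, fun _ _ _ _ _ => h⟩, spectralB_nd_toyReal⟩

end

end Summit.NavierStokesRegularity.NavierStokesRegularity.Theorems.RunbookJiaSverak
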